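import Summits.BirchSwinnertonDyer.BirchSwinnertonDyer.Theorems.UniversalToricDescentThinCombGradingRenormalisation
import Literature.NumberTheory.LocalFields.BinomialSeriesDifferentialEquation
import HarnessLib

/-!
# BINOMIAL VALUES OF GROUP-LIKE ELEMENTS: a normalised solution of `(1 + X)Q′ = zQ` IS the binomial series `(1+X)^z`, and the value
# `r(g)` of a character through the pair at `g ∈ Γ_K` with coordinates `(z, ·)` resp. `(0, e)` is `Q(r(γ₁) − 1)` resp. `Q(r(γ₂) − 1)`
# (helper on the rational wall `RationalSplitIMCInclusionAtThree`, stmt-BirchSwinnertonDyer-24207, line `ratwall_thin_comb`;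
# cell `pub/bsd-wall`, LEAD `cruxlead-24207` g38; `--supports stmt-BirchSwinnertonDyer-24207`; nothing is closed; BSD is not proved)

WHY THIS FILE. The tree's `ℂ_p` node theorems (`Literature…LocalFields.PadicComplex.exists_padicInt_binomial_twist_of_node_values`, used by
`…ThinComb.WildRigidity` in the first variable and by `…ThinComb.ColumnTwist` in the second) deliver a ratio `d = Q(u − 1)` with `Q ∈ ℂ_p⟦X⟧`
characterised by `(1 + X)·Q′ = z·Q`, `Q(0) = 1`, `z ∈ ℤ_p`. The FRAME FUNCTIONAL EQUATION (`…ThinComb.FrameFunctionalEquation`, this gen)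
turns such ratios into GROUP ELEMENTS `g ∈ Γ_K`: the group-like element `(1+T₁)^{κ₁ g}(1+T₂)^{κ₂ g}` of `g` takes the value `r(g)` at the
point of a character `r` through the pair (`…GradingRenormalisation.hasValueAt₂_groupLike`), and its factors are the binomial series
`PowerSeries.binomialSeries ℤ_[p] (κ_i g)`. This file identifies the two currencies:

* §1 `coeff_eq_choose_of_ode` — a solution of `(1 + X)·Q′ = z·Q` with `Q(0) = 1` has `[Xⁿ]Q = C(z, n)` (`Ring.choose`, Mathlib's
  `BinomialRing ℤ_[p]`): `n!·[Xⁿ]Q = z(z−1)⋯(z−n+1)` (`Literature…coeff_mul_factorial_of_ode`) `= n!·C(z,n)`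
  (`Ring.descPochhammer_eq_factorial_smul_choose`).
* §2 `hasValueAt₂_C_iff` (the value of `C F` at `(x, y)` is `F(y)`), `hasValueAt_binomialSeries_of_ode` (the value of
  `(binomialSeries ℤ_[p] z).map toUnr ∈ R₀⟦T⟧` at `x` is `Q(x)`).
* §3 **`avatarValueAt_eq_of_fst`** — for a character `r` through the pair with `r(γ₂) = 1` and `g` with `κ₁ g = z`: `r(g) = Q(r(γ₁) − 1)`;
  **`avatarValueAt_eq_of_snd`** — for any `r` through the pair and `g` with `κ₁ g = 0`, `κ₂ g = e`: `r(g) = Q(r(γ₂) − 1)`.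

HONEST SCOPE: bookkeeping (general `p`); nothing here is evidence that a toric frame exists at the additive split `3`; 24207 / 20395 / 20186 /
32493 OPEN; BSD is proved for no curve.

References: [cite: Gouvea1993PadicNumbers, §5.9 Lemma 5.9.1, Problem 194] [cite: deShalit1987, II.4.17 (54)] [cite: NeukirchSchmidtWingberg2008, (5.3.5)]
-/

set_option linter.dupNamespace false
set_option autoImplicit false

noncomputable section

open Filter Topology Field PowerSeries
open Literature.NumberTheory.EllipticCurves Literature.NumberTheory.GaloisRepresentations Literature.NumberTheory.LocalFields

namespace Summit.BirchSwinnertonDyer.BirchSwinnertonDyer.Theorems.UniversalToricDescentThinComb.BinomialValues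

open Summit.BirchSwinnertonDyer.Rank1Residual.X11b.Halves

variable {p : ℕ} [Fact p.Prime]

/-! ### §1. A normalised solution of the binomial differential equation is the binomial series -/

/-- The coercion `ℚ_p → ℂ_p` is the algebra map. [folklore] -/
theorem coe_padic_eq_algebraMap (q : ℚ_[p]) : ((q : ℚ_[p]) : ℂ_[p]) = algebraMap ℚ_[p] ℂ_[p] q := by
  rw [PadicComplex.coe_eq, IsScalarTower.algebraMap_apply ℚ_[p] (PadicAlgCl p) ℂ_[p]]

/-- **`[Xⁿ]Q = C(z, n)`** for a solution of `(1 + X)·Q′ = z·Q` with `Q(0) = 1`, `z ∈ ℤ_p`: both `n!·[Xⁿ]Q` and `n!·C(z, n)` equal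
`z(z−1)⋯(z−n+1)`. [cite: Gouvea1993PadicNumbers, §5.9 Lemma 5.9.1 (the binomial series `B(α, X)`)] -/
theorem coeff_eq_choose_of_ode {z : ℤ_[p]} {Q : PowerSeries ℂ_[p]}
    (hODE : (1 + X) * derivative ℂ_[p] Q = C (((z : ℚ_[p]) : ℂ_[p])) * Q) (hQ0 : constantCoeff Q = 1) (n : ℕ) :
    coeff n Q = algebraMap ℚ_[p] ℂ_[p] ((Ring.choose z n : ℤ_[p]) : ℚ_[p]) := by
  have h1 := coeff_mul_factorial_of_ode hODE n
  rw [hQ0, one_mul] at h1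
  -- in `ℤ_p`: `n!·C(z, n) = ∏_{j<n} (z − j)`
  have h2 : ((n.factorial : ℤ_[p]) * Ring.choose z n) = ∏ j ∈ Finset.range n, (z - (j : ℤ_[p])) := by
    rw [← nsmul_eq_mul, ← Ring.descPochhammer_eq_factorial_smul_choose, ← Polynomial.aeval_eq_smeval, Polynomial.aeval_def,
      ← Polynomial.eval_map, descPochhammer_map, descPochhammer_eval_eq_prod_range]
  -- map to `ℂ_p`
  set φ : ℤ_[p] →+* ℂ_[p] := (algebraMap ℚ_[p] ℂ_[p]).comp PadicInt.Coe.ringHom with hφ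
  have hφz : φ z = ((z : ℚ_[p]) : ℂ_[p]) := by rw [hφ, RingHom.comp_apply, coe_padic_eq_algebraMap]; rfl
  have h3 := congrArg φ h2
  rw [map_mul, map_natCast, map_prod] at h3
  simp_rw [map_sub, map_natCast, hφz] at h3
  have hn : (n.factorial : ℂ_[p]) ≠ 0 := by exact_mod_cast Nat.factorial_ne_zero n
  apply mul_left_cancel₀ hn
  rw [h1, ← h3, hφ, RingHom.comp_apply]
  rfl

/-! ### §2. Values of `C F` and of the binomial series -/

/-- **The value of `C F ∈ R₀⟦T₁⟧⟦T₂⟧` at `(x, y)` is the value of `F ∈ R₀⟦T₂⟧` at `y`** (only the terms with outer exponent `0` survive).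
[cite: deShalit1987, II.4.17 (52)–(54)] -/
theorem hasValueAt₂_C_iff (F : UnrSeries p) (x y v : ℂ_[p]) :
    UnrSeries.HasValueAt₂ (C F) x y v ↔ UnrSeries.HasValueAt F y v := by
  unfold UnrSeries.HasValueAt₂ UnrSeries.HasValueAt
  have hinj : Function.Injective (fun j : ℕ ↦ ((0 : ℕ), j)) := fun a b h ↦ by
    simpa using congrArg Prod.snd h
  rw [← hinj.hasSum_iff]
  · refine Iff.of_eq (congrArg (fun f ↦ HasSum f v) ?_)
    funext j
    simp [Function.comp, coeff_zero_C]
  · rintro ⟨i, j⟩ hij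
    rcases i with _ | i
    · exact absurd ⟨j, rfl⟩ hij
    · simp

/-- **The value of the binomial series `(binomialSeries ℤ_[p] z).map toUnr ∈ R₀⟦T⟧` at `x`, `‖x‖ < 1`, is `Q(x)`** for any normalised solution
`Q ∈ ℂ_p⟦X⟧` of `(1 + X)·Q′ = z·Q` (the two series have the same coefficients, §1). [cite: Gouvea1993PadicNumbers, §5.9 Lemma 5.9.1] -/
theorem hasValueAt_binomialSeries_of_ode {z : ℤ_[p]} {Q : PowerSeries ℂ_[p]}
    (hODE : (1 + X) * derivative ℂ_[p] Q = C (((z : ℚ_[p]) : ℂ_[p])) * Q) (hQ0 : constantCoeff Q = 1)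
    {x v : ℂ_[p]} (hv : HasSum (fun n ↦ coeff n Q * x ^ n) v) :
    UnrSeries.HasValueAt ((PowerSeries.binomialSeries ℤ_[p] z).map (toUnr p)) x v := by
  unfold UnrSeries.HasValueAt
  refine hv.congr_fun fun n ↦ ?_
  rw [coeff_map, coe_toUnr, binomialSeries_coeff, smul_eq_mul, mul_one, coeff_eq_choose_of_ode hODE hQ0 n]

/-! ### §3. Values of characters at group elements with prescribed coordinates -/

variable {K : Type} [Field K] [NumberField K]
  {κ₁ κ₂ : ZpExtension K p} {γ₁ γ₂ : absoluteGaloisGroup K} {r : FramedGaloisRep K (PadicAlgCl p) 1}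

/-- **`r(g) = Q(r(γ₁) − 1)` when `κ₁ g = z` and `r(γ₂) = 1`.** For a generator pair `(κ₁, κ₂; γ₁, γ₂)`, a character `r` through the pair
with `r(γ₂) = 1`, any `g ∈ Γ_K` with first coordinate `κ₁ g = z`, and a normalised solution `Q` of `(1 + X)·Q′ = z·Q` with `Q(r(γ₁) − 1) = d`:
`r(g) = d`. (The group-like element of `g` has the value `r(g)` at `(r γ₁ − 1, 0)`, where it restricts to `(1+T₁)^{κ₁ g}`.)
[cite: deShalit1987, II.4.17 (54)] [cite: NeukirchSchmidtWingberg2008, (5.3.5)] -/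
theorem avatarValueAt_eq_of_fst (hpair : ZpExtension.IsTopGeneratorPair κ₁ κ₂ γ₁ γ₂) (hr : FactorsThroughPair κ₁ κ₂ r)
    (hγ₂ : avatarValueAt r γ₂ = 1) {g : absoluteGaloisGroup K} {z : ℤ_[p]} (hg : Multiplicative.toAdd (κ₁ g) = z)
    {Q : PowerSeries ℂ_[p]} (hODE : (1 + X) * derivative ℂ_[p] Q = C (((z : ℚ_[p]) : ℂ_[p])) * Q) (hQ0 : constantCoeff Q = 1)
    {d : ℂ_[p]} (hd : HasSum (fun n ↦ coeff n Q * (avatarValueAt r γ₁ - 1) ^ n) d) :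
    avatarValueAt r g = d := by
  have h := GradingRenormalisation.hasValueAt₂_groupLike hpair hr g
  rw [hγ₂, sub_self, UnrSeries.hasValueAt₂_zero_right_iff, map_mul, PowerSeries.map_C, hg] at h
  have hmap : PowerSeries.map (constantCoeff (R := unrIntegers p))
      (PowerSeries.map (C (R := unrIntegers p)) ((PowerSeries.binomialSeries ℤ_[p] z).map (toUnr p))) =
        (PowerSeries.binomialSeries ℤ_[p] z).map (toUnr p) := by
    ext n
    simp [coeff_map]
  have hconst : constantCoeff (R := unrIntegers p) ((PowerSeries.binomialSeries ℤ_[p] (Multiplicative.toAdd (κ₂ g))).map (toUnr p)) = 1 := by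
    rw [← coeff_zero_eq_constantCoeff_apply, coeff_map, binomialSeries_coeff, Ring.choose_zero_right, one_smul, map_one]
  rw [hmap, hconst, map_one, mul_one] at h
  exact h.unique (hasValueAt_binomialSeries_of_ode hODE hQ0 hd)

/-- **`r(g) = Q(r(γ₂) − 1)` when `κ₁ g = 0`, `κ₂ g = e`.** For a generator pair, a character `r` through the pair, `g ∈ Γ_K` with coordinates
`(0, e)`, and a normalised solution `Q` of `(1 + X)·Q′ = e·Q` with `Q(r(γ₂) − 1) = w`: `r(g) = w`. (The group-like element of `g` is
`C ((1+T₂)^e)`, whose value at `(x, y)` is `(1+T₂)^e (y)`.) [cite: deShalit1987, II.4.17 (54)] [cite: NeukirchSchmidtWingberg2008, (5.3.5)] -/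
theorem avatarValueAt_eq_of_snd (hpair : ZpExtension.IsTopGeneratorPair κ₁ κ₂ γ₁ γ₂) (hr : FactorsThroughPair κ₁ κ₂ r)
    {g : absoluteGaloisGroup K} {e : ℤ_[p]} (hg₁ : Multiplicative.toAdd (κ₁ g) = 0) (hg₂ : Multiplicative.toAdd (κ₂ g) = e)
    {Q : PowerSeries ℂ_[p]} (hODE : (1 + X) * derivative ℂ_[p] Q = C (((e : ℚ_[p]) : ℂ_[p])) * Q) (hQ0 : constantCoeff Q = 1)
    {w : ℂ_[p]} (hw : HasSum (fun n ↦ coeff n Q * (avatarValueAt r γ₂ - 1) ^ n) w) :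
    avatarValueAt r g = w := by
  have h := GradingRenormalisation.hasValueAt₂_groupLike hpair hr g
  rw [hg₁, hg₂, binomialSeries_zero, map_one, map_one, one_mul, hasValueAt₂_C_iff] at h
  exact h.unique (hasValueAt_binomialSeries_of_ode hODE hQ0 hw)

end Summit.BirchSwinnertonDyer.BirchSwinnertonDyer.Theorems.UniversalToricDescentThinComb.BinomialValues

end
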